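import Summits.QuantumFields.YangMills.Theorems.WeakCouplingRatesCalibrationTransfer
import Summits.QuantumFields.YangMills.Theorems.WeakCouplingRates
import Summits.QuantumFields.YangMills.Theorems.LangevinControlUVOSLegsFromFemtoAndGapDefs
import Summits.Ventures.YMGap.RobustBall.TransferGapTorus
import HarnessLib

/-!
# Weak-coupling rates, calibration part 3/3: THE CALIBRATION INEQUALITIES — ladder units versus RP-spectral upper rates

NOT THE CLAY GAP.  Cell `ym-beyond`, seat P3 «lower the summit honestly»; ladder rung R2ξ = `WeakCouplingRates.XiPowSU2` (coordinator ruling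
2026-08-25, stature 5–10, NON-summit-bearing), caption verbatim: «not the Clay direction; constraint on R2c schemes».  This module makes the
caption a theorem.  All `d = 4`; `GapInUnits G r a` is H3 of `OSLegsFromFemtoAndGap` = the conclusion of `BalabanLadder.IR` (rung R2c): a
volume-uniform gap `c₁·a(β)` in the units `a` on the odd tori `S ≥ S₁(β)`, `β ≥ β₂`.
* §D `torusClusteringAt_of_gapInUnits` (small tori absorbed into the constant); `oddTorusLimitPoints_nonempty` (compactness: the currencies are
  not vacuous);
* §E `hasRPTimeGap_of_torusClusteringAt` (torus clustering ⇒ RP-spectral gap of every odd-torus limit state, via RobustBall's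
  `hasInfiniteVolumeGap_of_torusClusteringAt` and part 2); THE CALIBRATION INEQUALITY `rate_eventually_ge_of_gapInUnits`:
  `GapInUnits G r a ∧ a > 0 ⇒ ∃ c₁ > 0, ∀ rate, MassGapUpperRateOf 4 r.ρ rate → ∀ᶠ β, c₁·a β ≤ rate β`; with XI-DIV (`MassGapVanishesOf`):
  `a → 0` (`tendsto_zero_of_gapInUnits` — the clause `Tendsto a atTop (𝓝 0)` of `BalabanLadder.NT/IR` is FORCED by the gap clause); with
  XI-POW(ε) (`MassGapPowerDecayOf`): `a β ≤ β^{-ε}/c₁` eventually (`unit_le_rpow_of_gapInUnits`);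
* §F every compact simple `G` (XI-DIV proved, `massGapVanishesOf_allSimpleG`): `tendsto_zero_of_gapInUnits_of_simple`;
* §G `SU(2)`: `su2_unit_le_rpow_of_xiPowSU2 : XiPowSU2 → GapInUnits SU(2) (fundamentalLatticeRep 2) a → a β ≤ β^{-ε}/c₁ eventually` — rung R2ξ
  read as a constraint on the unit maps of rung R2c.
WHAT THIS IS NOT: no gap is bounded from below anywhere; nothing about the continuum limit or Clay.
References: K. Osterwalder, E. Seiler, Ann. Phys. 110 (1978) §2; E. Seiler, LNP 159 (1982) Ch. 2; S. Chatterjee, arXiv:1803.01950 §2, §5;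
T. Bałaban, Commun. Math. Phys. 122 (1989) 355 (large-field renormalisation, the source of unit maps `a(β)`).
-/

set_option autoImplicit false

noncomputable section

open scoped BigOperators Topology ComplexConjugate ComplexOrder InnerProductSpace
open MeasureTheory Filter
open Literature.MathematicalPhysics Literature.MathematicalPhysics.QuantumFieldTheory
  Literature.MathematicalPhysics.QuantumLattice
open Literature.Probability.LatticeModels (IsOSReconstructible IsBoundedMeasurable positiveEvents osForm
  TransferData)
open Summit.QuantumFields.YangMills.Theorems.ClusteringToYangMills.Reconstructible
open Summit.QuantumFields.YangMills.Theorems.CriticalContinuumLimit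
open Summit.QuantumFields.YangMills.Theorems.CriticalContinuumLimit.AdmissibleGap
open Summit.Ventures.YMGap.RobustBall.TransferGap (abs_latticeConnectedCorr_le_two_mul
  hasInfiniteVolumeGap_of_torusClusteringAt oddTorusLimitPoints_subset_infiniteVolumeLimitPoints)
open Summit.QuantumFields.YangMills.Cruxes.OSLegsFromFemtoAndGap.DlrCollarTransfer (GapInUnits)

namespace Summit.QuantumFields.YangMills.Theorems.WeakCouplingRates

/-! ### §D. Ladder units ⇒ torus clustering on all odd tori; odd-torus limit states exist -/

section Ladder

variable {G : Type} [Group G] [TopologicalSpace G] [IsTopologicalGroup G] [CompactSpace G]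
  [MeasurableSpace G] [BorelSpace G]

/-- **Ladder units ⇒ torus clustering.** If the lattice theory has a volume-uniform gap `c₁·a(β)` in the units `a` on the odd
tori `S ≥ S₁(β)` (`GapInUnits G r a` = H3 of `OSLegsFromFemtoAndGap`, the output of `BalabanLadder.IR`), then for every `β ≥ β₂`
with `a β ≥ 0` the summit's `TorusClusteringAt r β (c₁ a β)` holds on ALL odd tori: the finitely many tori `S < S₁ β` are absorbed
into the constant `2 M_A M_B e^{c₁ a(β) S₁(β)}` (`abs_latticeConnectedCorr_le_two_mul`).  NOT THE CLAY GAP. [folklore] -/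
theorem torusClusteringAt_of_gapInUnits (r : LatticeRep G) {a : ℝ → ℝ} (h : GapInUnits G r a) :
    ∃ c₁ β₂ : ℝ, 0 < c₁ ∧ ∀ β : ℝ, β₂ ≤ β → 0 ≤ a β → TorusClusteringAt r β (c₁ * a β) := by
  obtain ⟨c₁, β₂, S₁, hc₁, hAB⟩ := h
  refine ⟨c₁, β₂, hc₁, fun β hβ ha A B => ?_⟩
  obtain ⟨C, hC⟩ := hAB A B
  obtain ⟨MA, hMA⟩ := A.bounded
  obtain ⟨MB, hMB⟩ := B.bounded
  have hm : 0 ≤ c₁ * a β := mul_nonneg hc₁.le ha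
  refine ⟨max C (2 * (MA * MB) * Real.exp (c₁ * a β * S₁ β)), fun S n hn => ?_⟩
  by_cases hS : S₁ β ≤ S
  · exact (hC β hβ S n hS hn).trans
      (mul_le_mul_of_nonneg_right (le_max_left _ _) (Real.exp_nonneg _))
  · have hlt : n < S₁ β := lt_of_le_of_lt hn (not_le.1 hS)
    have hbd := abs_latticeConnectedCorr_le_two_mul r β S hMA hMB n
    have hMAB : 0 ≤ 2 * (MA * MB) := by
      have := (abs_nonneg _).trans (hMA 1); have := (abs_nonneg _).trans (hMB 1); positivity
    have hexp : 1 ≤ Real.exp (c₁ * a β * S₁ β) * Real.exp (-(c₁ * a β * n)) := by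
      rw [← Real.exp_add]
      refine Real.one_le_exp ?_
      have hnS : (n : ℝ) ≤ S₁ β := by exact_mod_cast hlt.le
      nlinarith [mul_le_mul_of_nonneg_left hnS hm]
    calc |latticeConnectedCorr r.ρ β (2 * S + 1) A.F B.F n| ≤ 2 * (MA * MB) * 1 := by rw [mul_one]; exact hbd
      _ ≤ 2 * (MA * MB) * (Real.exp (c₁ * a β * S₁ β) * Real.exp (-(c₁ * a β * n))) :=
          mul_le_mul_of_nonneg_left hexp hMAB
      _ = 2 * (MA * MB) * Real.exp (c₁ * a β * S₁ β) * Real.exp (-(c₁ * a β * n)) := by ring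
      _ ≤ max C (2 * (MA * MB) * Real.exp (c₁ * a β * S₁ β)) * Real.exp (-(c₁ * a β * n)) :=
          mul_le_mul_of_nonneg_right (le_max_right _ _) (Real.exp_nonneg _)

/-- **Odd-torus limit states exist** (every `β`, every compact second-countable Hausdorff `G`): the torus Wilson states on the odd tori
`(ℤ/(2S+1))⁴`, transported to `G^{edges(ℤ⁴)}`, have a subsequence converging on bounded continuous cylinder observables — compactness and
metrisability of the space of probability measures on the compact metrisable configuration space (as in the tree's
`infiniteVolumeLimitPoints_nonempty_holds`; Seiler LNP 159 Ch. 2, Chatterjee arXiv:1803.01950 §2).  In particular `HasInfiniteVolumeGap` and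
the calibration below are NOT vacuous. [cite: arXiv180301950, §2] -/
theorem oddTorusLimitPoints_nonempty [T2Space G] [SecondCountableTopology G] (r : LatticeRep G) (β : ℝ) :
    ∃ μ : Measure (LGConfig 4 G), IsProbabilityMeasure μ ∧ μ ∈ oddTorusLimitPoints r β := by
  have hρ := r.continuous
  haveI := fun S : ℕ => isProbabilityMeasure_torusState (d := 4) (L := 2 * S + 1) r.ρ hρ β
  let P : ℕ → ProbabilityMeasure (LGConfig 4 G) := fun S => ⟨torusState r.ρ β (2 * S + 1), inferInstance⟩
  obtain ⟨ν, -, φ, hφ, hlim⟩ :=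
    (isCompact_univ (X := ProbabilityMeasure (LGConfig 4 G))).tendsto_subseq fun n => Set.mem_univ (P n)
  refine ⟨(ν : Measure (LGConfig 4 G)), inferInstance, φ, hφ, inferInstance, fun F S _ hFc hFb => ?_⟩
  obtain ⟨C, hC⟩ := hFb
  let Fb : BoundedContinuousFunction (LGConfig 4 G) ℝ :=
    BoundedContinuousFunction.ofNormedAddCommGroup F hFc C
      (fun U => by simpa [Real.norm_eq_abs] using hC U)
  have key : Tendsto (fun k : ℕ => ∫ U, Fb U ∂(P (φ k) : Measure (LGConfig 4 G))) atTop
      (𝓝 (∫ U, Fb U ∂(ν : Measure (LGConfig 4 G)))) :=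
    (ProbabilityMeasure.tendsto_iff_forall_integral_tendsto.1 hlim) Fb
  refine key.congr' (Eventually.of_forall fun k => ?_)
  exact (wilsonExpectation_toTorusObservable r.ρ β (2 * φ k + 1) hFc.measurable).symm

end Ladder

/-! ### §E. The calibration inequalities -/

section Calibration

variable {G : Type} [Group G] [TopologicalSpace G] [IsTopologicalGroup G] [CompactSpace G]
  [MeasurableSpace G] [BorelSpace G]

/-- **Torus clustering ⇒ RP-spectral gap** (Euclidean in, Euclidean out): volume-uniform exponential clustering with rate `m > 0` of
the gauge-invariant local observables on the odd tori at `β ≥ 0` implies, for EVERY odd-torus limit state and EVERY bounded continuous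
positive-time cylinder observable `F` (gauge invariant or not), `rpCorr μ F t ≤ e^{-m t} rpCorr μ F 0`.  Composition of
`hasInfiniteVolumeGap_of_torusClusteringAt` (Ventures/RobustBall, no simplicity hypothesis) and §C.  NOT THE CLAY GAP. [folklore] -/
theorem hasRPTimeGap_of_torusClusteringAt (r : LatticeRep G) {β m : ℝ} (hβ : 0 ≤ β) (hm : 0 < m)
    (hcl : TorusClusteringAt r β m) {μ : Measure (LGConfig 4 G)} [IsProbabilityMeasure μ]
    (hμ : μ ∈ oddTorusLimitPoints r β) : HasRPTimeGap μ m := by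
  haveI : SecondCountableTopology G :=
    (r.continuous.isClosedEmbedding r.injective).isEmbedding.secondCountableTopology
  exact hasRPTimeGap_of_hasInfiniteVolumeGap r hβ (hasInfiniteVolumeGap_of_torusClusteringAt r hβ hm hcl) hμ

/-- **THE CALIBRATION INEQUALITY.**  If the lattice Yang–Mills theory of `(G, r)` has a volume-uniform gap in the units `a > 0`
(`GapInUnits G r a`: rate `c₁ a(β)` on the odd tori `S ≥ S₁(β)`, `β ≥ β₂`), then EVERY upper rate for the RP-spectral gap of the
torus-limit states (`MassGapUpperRateOf 4 r.ρ rate`, P3's currency) bounds the unit map: `c₁ · a β ≤ rate β` for all large `β`.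
Chain: `GapInUnits ⇒ TorusClusteringAt (c₁ a β)` (§D) `⇒ HasInfiniteVolumeGap` (RobustBall) `⇒ HasRPTimeGap μ (c₁ a β)` (§C) for an
odd-torus limit state `μ`, which EXISTS (§D) and is an infinite-volume limit point, `⇒ c₁ a β ≤ rate β`.  NOT THE CLAY GAP. [folklore] -/
theorem rate_eventually_ge_of_gapInUnits (r : LatticeRep G) {a : ℝ → ℝ} (ha : ∀ β, 0 < a β) (hgap : GapInUnits G r a) :
    ∃ c₁ : ℝ, 0 < c₁ ∧ ∀ rate : ℝ → ℝ, MassGapUpperRateOf 4 r.ρ rate → ∀ᶠ β : ℝ in atTop, c₁ * a β ≤ rate β := by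
  haveI : SecondCountableTopology G :=
    (r.continuous.isClosedEmbedding r.injective).isEmbedding.secondCountableTopology
  haveI : T2Space G := (r.continuous.isClosedEmbedding r.injective).isEmbedding.t2Space
  obtain ⟨c₁, β₂, hc₁, hcl⟩ := torusClusteringAt_of_gapInUnits r hgap
  refine ⟨c₁, hc₁, fun rate hrate => ?_⟩
  obtain ⟨β₀, hβ₀⟩ := hrate
  filter_upwards [eventually_ge_atTop β₂, eventually_ge_atTop β₀, eventually_ge_atTop (0 : ℝ)] with β hβ2 hβ0 hβ
  have hm : 0 < c₁ * a β := mul_pos hc₁ (ha β)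
  have hG : HasInfiniteVolumeGap r β (c₁ * a β) :=
    hasInfiniteVolumeGap_of_torusClusteringAt r hβ hm (hcl β hβ2 (ha β).le)
  obtain ⟨μ, hμP, hμ⟩ := oddTorusLimitPoints_nonempty r β
  exact hβ₀ β hβ0 μ (oddTorusLimitPoints_subset_infiniteVolumeLimitPoints r β hμ) _
    (hasRPTimeGap_of_hasInfiniteVolumeGap r hβ hG hμ)

/-- **A unit map carrying a volume-uniform lattice gap tends to zero under XI-DIV.**  `GapInUnits G r a`, `a > 0` and XI-DIV
(`MassGapVanishesOf 4 r.ρ`: for every `ε > 0` no torus-limit state has RP-spectral gap `> ε` at large `β`) force `a(β) → 0`: the clause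
`Tendsto a atTop (𝓝 0)` carried by `BalabanLadder.NT`/`IR` is not an extra hypothesis but a CONSEQUENCE of the gap clause.  XI-DIV is a
theorem for every compact simple `G` (`massGapVanishesOf_allSimpleG`); see `tendsto_zero_of_gapInUnits_of_simple`.  NOT THE CLAY GAP. [folklore] -/
theorem tendsto_zero_of_gapInUnits (r : LatticeRep G) {a : ℝ → ℝ} (ha : ∀ β, 0 < a β) (hgap : GapInUnits G r a)
    (hdiv : MassGapVanishesOf 4 r.ρ) : Tendsto a atTop (𝓝 0) := by
  obtain ⟨c₁, hc₁, h⟩ := rate_eventually_ge_of_gapInUnits r ha hgap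
  rw [Metric.tendsto_nhds]
  intro ε hε
  have h' := h (fun _ => c₁ * (ε / 2)) (hdiv (c₁ * (ε / 2)) (by positivity))
  filter_upwards [h'] with β hβ
  have hβ' : c₁ * a β ≤ c₁ * (ε / 2) := hβ
  rw [Real.dist_eq, sub_zero, abs_of_pos (ha β)]
  have : a β ≤ ε / 2 := le_of_mul_le_mul_left hβ' hc₁
  linarith

/-- **XI-POW(ε) calibrates the units by a power law.**  `GapInUnits G r a`, `a > 0` and `MassGapPowerDecayOf 4 r.ρ ε` (the leaf XI-POW:
RP-spectral gaps `≤ β^{-ε}` at large `β`) give `a β ≤ β^{-ε} / c₁` for all large `β` — any unit map in which the lattice has a volume-uniform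
gap decays at least like a power of `β` (asymptotic freedom predicts `a ≍ β^{c} e^{-c' β}`).  NOT THE CLAY GAP. [folklore] -/
theorem unit_le_rpow_of_gapInUnits (r : LatticeRep G) {a : ℝ → ℝ} (ha : ∀ β, 0 < a β) (hgap : GapInUnits G r a) {ε : ℝ}
    (hpow : MassGapPowerDecayOf 4 r.ρ ε) : ∃ c₁ : ℝ, 0 < c₁ ∧ ∀ᶠ β : ℝ in atTop, a β ≤ β ^ (-ε) / c₁ := by
  obtain ⟨c₁, hc₁, h⟩ := rate_eventually_ge_of_gapInUnits r ha hgap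
  refine ⟨c₁, hc₁, ?_⟩
  filter_upwards [h (fun β => β ^ (-ε)) hpow] with β hβ
  have hβ' : c₁ * a β ≤ β ^ (-ε) := hβ
  rw [le_div_iff₀ hc₁, mul_comm]
  exact hβ'

end Calibration

/-! ### §F. Every compact simple `G`: the units of a volume-uniform lattice gap tend to zero (XI-DIV is proved there) -/

section Simple

/-- **Every compact simple `G`, `d = 4`, Borel σ-algebra: a unit map carrying a volume-uniform lattice gap tends to zero** —
`tendsto_zero_of_gapInUnits` with XI-DIV discharged by the tree theorem `massGapVanishesOf_allSimpleG` (route `EquipartitionCriticality`).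
Reading for the ladder: in `BalabanLadder.NT`/`IR` the conjunct `Tendsto a atTop (𝓝 0)` is implied by the conjunct `GapInUnits G r a` (given
`a > 0`).  NOT THE CLAY GAP (no positivity of any gap is asserted; the content is an upper bound on lattice gaps). [folklore] -/
theorem tendsto_zero_of_gapInUnits_of_simple (G : Type) [Group G] [TopologicalSpace G] [IsTopologicalGroup G] [CompactSpace G]
    (hG : IsCompactSimpleLieGroup G) :
    letI : MeasurableSpace G := borel G
    haveI : BorelSpace G := ⟨rfl⟩
    ∀ (r : LatticeRep G) (a : ℝ → ℝ), (∀ β, 0 < a β) → GapInUnits G r a → Tendsto a atTop (𝓝 0) := by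
  letI : MeasurableSpace G := borel G
  haveI : BorelSpace G := ⟨rfl⟩
  intro r a ha hgap
  exact tendsto_zero_of_gapInUnits r ha hgap (massGapVanishesOf_allSimpleG G hG r)

end Simple

/-! ### §G. `SU(2)`: rung R2ξ (`XiPowSU2`) as a constraint on the unit maps of rung R2c (`GapInUnits`) -/

section SU2

/-- **«Constraint on R2c schemes» — the caption of rung R2ξ as a theorem.**  If `XiPowSU2` holds (every torus-limit state of four-dimensional
`SU(2)` lattice Yang–Mills, fundamental Wilson action, has RP-spectral gap `≤ β^{-ε}` at large `β`), then every unit map `a > 0` in which that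
lattice theory has a volume-uniform gap — `GapInUnits SU(2) (fundamentalLatticeRep 2) a`, the `IR` leg of `BalabanLadder` at `G = SU(2)` —
satisfies `a β ≤ β^{-ε} / c₁` for all large `β` (`ε` of `XiPowSU2`, `c₁` of `GapInUnits`).  NOT THE CLAY GAP. [folklore] -/
theorem su2_unit_le_rpow_of_xiPowSU2 (hξ : XiPowSU2) {a : ℝ → ℝ} (ha : ∀ β, 0 < a β)
    (hgap : GapInUnits (Matrix.specialUnitaryGroup (Fin 2) ℂ) (fundamentalLatticeRep 2) a) :
    ∃ ε c₁ : ℝ, 0 < ε ∧ 0 < c₁ ∧ ∀ᶠ β : ℝ in atTop, a β ≤ β ^ (-ε) / c₁ := by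
  obtain ⟨ε, hε, hpow⟩ := hξ
  obtain ⟨c₁, hc₁, h⟩ := unit_le_rpow_of_gapInUnits (fundamentalLatticeRep 2) ha hgap hpow
  exact ⟨ε, c₁, hε, hc₁, h⟩

/-- **`SU(2)`, given the tree's named simplicity fact: a unit map carrying a volume-uniform lattice gap tends to zero** (XI-DIV for `SU(2)` via
`massGapVanishesOf_allSimpleG` and `isCompactSimpleLieGroup_specialUnitaryGroup`; the hypothesis is the Literature's unproved named fact
`isSimpleCompactGroup_specialUnitaryGroup`, consumed exactly as the summit statement consumes it).  NOT THE CLAY GAP. [folklore] -/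
theorem su2_tendsto_zero_of_gapInUnits (hs : isSimpleCompactGroup_specialUnitaryGroup.{0}) {a : ℝ → ℝ} (ha : ∀ β, 0 < a β)
    (hgap : GapInUnits (Matrix.specialUnitaryGroup (Fin 2) ℂ) (fundamentalLatticeRep 2) a) : Tendsto a atTop (𝓝 0) :=
  tendsto_zero_of_gapInUnits (fundamentalLatticeRep 2) ha hgap
    (massGapVanishesOf_allSimpleG _ (isCompactSimpleLieGroup_specialUnitaryGroup hs (le_refl 2)) (fundamentalLatticeRep 2))

/-- **`SU(2)`: a unit map carrying a volume-uniform lattice gap tends to zero** — unconditional (XI-DIV for `SU(2)` via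
`massGapVanishesOf_allSimpleG`, `isCompactSimpleLieGroup_specialUnitaryGroup` and the tree's PROVED simplicity theorem
`isSimpleCompactGroup_specialUnitaryGroup_holds`).  In words: the hypothesis `Tendsto a atTop (𝓝 0)` that `BalabanLadder.IR` places next to
`GapInUnits` is implied by `GapInUnits` itself at `G = SU(2)`.  NOT THE CLAY GAP.  (Author's revision of 2026-08-25T21:26:42Z, payload
`LIFT-P3-WeakCouplingRatesCalibration.lean` sha16 c9b0bca89e19de3d, statement and proof verbatim; appended under the primed name by the courier
seat because the pre-revision conditional form above had already landed (p408767) and Theorems files are append-only — it supersedes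
`su2_tendsto_zero_of_gapInUnits`, which is the special case `hs := isSimpleCompactGroup_specialUnitaryGroup_holds`.) [folklore] -/
theorem su2_tendsto_zero_of_gapInUnits' {a : ℝ → ℝ} (ha : ∀ β, 0 < a β)
    (hgap : GapInUnits (Matrix.specialUnitaryGroup (Fin 2) ℂ) (fundamentalLatticeRep 2) a) : Tendsto a atTop (𝓝 0) :=
  tendsto_zero_of_gapInUnits (fundamentalLatticeRep 2) ha hgap
    (massGapVanishesOf_allSimpleG _
      (isCompactSimpleLieGroup_specialUnitaryGroup isSimpleCompactGroup_specialUnitaryGroup_holds le_rfl) (fundamentalLatticeRep 2))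

end SU2

end Summit.QuantumFields.YangMills.Theorems.WeakCouplingRates

end
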